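import Summits.CriticalPhenomena.PercolationContinuityZ3.Theorems.PercNearOneGluingNoHeavyQuantLSCoreMMGIneqA
import Summits.CriticalPhenomena.PercolationContinuityZ3.Theorems.PercNearOneGluingNoHeavyQuantLSCoreLLGIneqA
import Summits.CriticalPhenomena.PercolationContinuityZ3.Theorems.PercNearOneGluingNoHeavyQuantLSCoreLLGIneqG
import Summits.CriticalPhenomena.PercolationContinuityZ3.Theorems.PercNearOneGluingNoHeavyQuantLSCoreLMGCellsK
import Mathlib.Tactic.Linarith
import Mathlib.Tactic.FieldSimp
import Mathlib.Tactic.Ring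
import HarnessLib

/-!
# QUANT lane R8, T-DEC, binder (II) `ConvClosedTResidue`: LS-CORE, pattern LLG — the breakpoint inequalities of the two-low greedy after
# pre-routing both row-`m` lows into the head cell (kB)

builds on p205010 (kernel theorem, internal audit signed; external expert review pending)

Support file (`--supports stmt-CriticalPhenomena-4575`), QUANT lane seat prim-quant-census-1 (gen 22), rung R8 of
`run/shared/lean/prim/quant/LADDER.md`.  Theorems only, standard axioms, no sorries.  Memo `…/prim-quant-census-1/LSCORE-G22.md` §9–§10.

Pattern LLG (`2(m+l′) < T`): both light cells of row `m` are lows; `m+l′` (pair "4", deficit `r+d−2w`, span `1−w`, always light) and then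
`m+l` (pair "3") are pre-routed into the head cell `p+h`, rests to the giant; the two row-`p` lows then see the head cell (residual capacity
`cPres`) and the residual pool.  Where a cell would be too large for a certificate the light pre-routing efficiency is replaced by its
lower bound `1/x − 1` (a light pair never costs more than the giant rate) — a monotone weakening proved inside the lemma.

[this work].  The gluing rows served [cite: KozmaNitzan2024, Conjecture 3 (p. 15)]; product measure [cite: Grimmett1999, §1.3 p. 10].
-/

namespace Summit.CriticalPhenomena.PercolationContinuityZ3.Theorems

namespace Quant

namespace LawDec

namespace LSCoreLLG

set_option maxHeartbeats 8000000 in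
/-- `kB` for pattern LLG, pre-routing pair `m+l` heavy, first pair available, head pair light (one branch of the case tree of `kB_LLG`). [this work] -/
theorem kB_LLG_H1L (x r t d w e2P e3 κP cP1 pool1 cPres poolres : ℝ) (hx0 : 0 < x) (hx1 : x < 1) (hr0 : 0 ≤ r) (hrx : r < x) (ht : 0 < t) (hw0 : 0 < w) (hw1 : w < 1)
    (hd0 : 0 ≤ d) (hdx : d < x * w) (hre : 0 < r - x + t * (2 - x)) (hre1 : 0 < 1 - t - r)
    (hM2 : 2 * w < r + d)
    (_h2P_N : 1 ≤ (r + d) → e2P = 0)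
    (_h2P_H : x ≤ (r + d) → (r + d) < 1 → e2P = (1 / (r + d) - 1))
    (h2P_L : (r + d) < x → e2P = (1 / ((1 - x) * (r + d) + x ^ (2:ℕ)) - 1))
    (h3_H : x * (1 + t - w) ≤ (r + d + 2 * t - 2 * w) → e3 = (((1 + t - w) - (r + d + 2 * t - 2 * w)) / (r + d + 2 * t - 2 * w)))
    (_h3_L : (r + d + 2 * t - 2 * w) < x * (1 + t - w) → e3 = (((1 + t - w) - ((1 - x) * (r + d + 2 * t - 2 * w) + x ^ (2:ℕ) * (1 + t - w))) / ((1 - x) * (r + d + 2 * t - 2 * w) + x ^ (2:ℕ) * (1 + t - w))))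
    (_hκ_N : 1 + t ≤ (r + d + 2 * t) → κP = 0) (_hκ_H : (r + d + 2 * t) < 1 + t → x ≤ (r + d) → (r + d) < 1 → κP = (((1 + t) - (r + d + 2 * t)) * (r + d) / ((r + d + 2 * t) * (1 - (r + d))))) (hκ_L : (r + d + 2 * t) < 1 + t → (r + d) < x → κP = (((1 + t) - (r + d + 2 * t)) * ((1 - x) * (r + d) + x ^ (2:ℕ)) / ((r + d + 2 * t) * (1 - ((1 - x) * (r + d) + x ^ (2:ℕ))))))
    (hc4_f : ((x ^ (2:ℕ) + (1 - x) * d / w) * (1 - x) * ((1 + x - r) * (r - x + t * (2 - x)) / (t * (2 - x ^ (2:ℕ) - (1 - x) * r) - x * (x - r)))) ≤ ((1 - (x ^ (2:ℕ) + (1 - x) * d / w)) * x) * (((1 - w) - ((1 - x) * (r + d - 2 * w) + x ^ (2:ℕ) * (1 - w))) / ((1 - x) * (r + d - 2 * w) + x ^ (2:ℕ) * (1 - w))) → cP1 = ((1 - (x ^ (2:ℕ) + (1 - x) * d / w)) * x) - ((x ^ (2:ℕ) + (1 - x) * d / w) * (1 - x) * ((1 + x - r) * (r - x + t * (2 - x))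 / (t * (2 - x ^ (2:ℕ) - (1 - x) * r) - x * (x - r)))) / (((1 - w) - ((1 - x) * (r + d - 2 * w) + x ^ (2:ℕ) * (1 - w))) / ((1 - x) * (r + d - 2 * w) + x ^ (2:ℕ) * (1 - w))) ∧ pool1 = ((x ^ (2:ℕ) + (1 - x) * d / w) * (1 - x)))
    (_hc4_s : ((1 - (x ^ (2:ℕ) + (1 - x) * d / w)) * x) * (((1 - w) - ((1 - x) * (r + d - 2 * w) + x ^ (2:ℕ) * (1 - w))) / ((1 - x) * (r + d - 2 * w) + x ^ (2:ℕ) * (1 - w))) < ((x ^ (2:ℕ) + (1 - x) * d / w) * (1 - x) * ((1 + x - r) * (r - x + t * (2 - x)) / (t * (2 - x ^ (2:ℕ) - (1 - x) * r) - x * (x - r)))) → cP1 = 0 ∧ pool1 = (((x ^ (2:ℕ) + (1 - x) * d / w) * (1 - x)) - ((x ^ (2:ℕ) + (1 - x) * d / w) * (1 - x) * ((1 + x - r) * (r - x + t * (2 - x)) / (t * (2 - x ^ (2:ℕ) - (1 - x) * r) - x * (x - r)))) + ((1 - (x ^ (2:ℕ) + (1 - x) * d / w)) * x) * (((1 - w)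 - ((1 - x) * (r + d - 2 * w) + x ^ (2:ℕ) * (1 - w))) / ((1 - x) * (r + d - 2 * w) + x ^ (2:ℕ) * (1 - w)))))
    (hc3_f : ((x ^ (2:ℕ) + (1 - x) * d / w) * (1 - x) * ((x - r) * (1 - t - r) / (t * (2 - x ^ (2:ℕ) - (1 - x) * r) - x * (x - r)))) ≤ cP1 * e3 → cPres = cP1 - ((x ^ (2:ℕ) + (1 - x) * d / w) * (1 - x) * ((x - r) * (1 - t - r) / (t * (2 - x ^ (2:ℕ) - (1 - x) * r) - x * (x - r)))) / e3 ∧ poolres = pool1)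
    (_hc3_s : cP1 * e3 < ((x ^ (2:ℕ) + (1 - x) * d / w) * (1 - x) * ((x - r) * (1 - t - r) / (t * (2 - x ^ (2:ℕ) - (1 - x) * r) - x * (x - r)))) → cPres = 0 ∧ poolres = (pool1 - ((x ^ (2:ℕ) + (1 - x) * d / w) * (1 - x) * ((x - r) * (1 - t - r) / (t * (2 - x ^ (2:ℕ) - (1 - x) * r) - x * (x - r)))) + cP1 * e3))
    (_hav : (r + d) < 1) (hf4 : ((x ^ (2:ℕ) + (1 - x) * d / w) * (1 - x) * ((1 + x - r) * (r - x + t * (2 - x)) / (t * (2 - x ^ (2:ℕ) - (1 - x) * r) - x * (x - r)))) ≤ ((1 - (x ^ (2:ℕ) + (1 - x) * d / w)) * x) * (((1 - w) - ((1 - x) * (r + d - 2 * w) + x ^ (2:ℕ) * (1 - w))) / ((1 - x) * (r + d - 2 * w) + x ^ (2:ℕ) * (1 - w)))) (hf3 : ((x ^ (2:ℕ) + (1 - x) * d / w) * (1 - x) * ((x - r) * (1 - t - r) / (t * (2 - x ^ (2:ℕ) - (1 - x) * r) - x * (x - r)))) ≤ cP1 * e3) (hpre : ((1 - (x ^ (2:ℕ)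 + (1 - x) * d / w)) * (1 - x) * ((1 + x - r) * (r - x + t * (2 - x)) / (t * (2 - x ^ (2:ℕ) - (1 - x) * r) - x * (x - r)))) ≤ cPres * e2P)
    (hk3 : x * (1 + t - w) ≤ (r + d + 2 * t - 2 * w)) (h1P : (r + d + 2 * t) < 1 + t) (h2L : (r + d) < x) :
    ((1 - (x ^ (2:ℕ) + (1 - x) * d / w)) * (1 - x) * ((x - r) * (1 - t - r) / (t * (2 - x ^ (2:ℕ) - (1 - x) * r) - x * (x - r)))) ≤ (cPres * e2P - ((1 - (x ^ (2:ℕ) + (1 - x) * d / w)) * (1 - x) * ((1 + x - r) * (r - x + t * (2 - x)) / (t * (2 - x ^ (2:ℕ) - (1 - x) * r) - x * (x - r))))) * κP + poolres := by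
  have hD : 0 < t * (2 - x ^ (2:ℕ) - (1 - x) * r) - x * (x - r) := LSCoreMMG.D_pos x r t hx0 hx1 hr0 hrx hre
  have hxw : x * w ≤ x := by
    have h_ := mul_pos hx0 (sub_pos.2 hw1)
    linarith
  have hb4 : r + d - 2 * w < x * (1 - w) := by
    have h_ := mul_pos hw0 (sub_pos.2 hx1)
    linarith
  have hb4c : r + d - 2 * w < 1 - w := by
    have h_ := mul_pos (sub_pos.2 hw1) (sub_pos.2 hx1)
    linarith
  have hb3c : r + d + 2 * t - 2 * w < 1 + t - w := by
    have h_ := mul_pos hw0 (sub_pos.2 hx1)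
    linarith
  have hg0 : 0 ≤ (x ^ (2:ℕ) + (1 - x) * d / w) := by positivity
  have hlam : 0 ≤ ((x - r) * (1 - t - r) / (t * (2 - x ^ (2:ℕ) - (1 - x) * r) - x * (x - r))) := div_nonneg (mul_nonneg (by linarith) (by linarith)) hD.le
  have hlaml : 0 ≤ ((1 + x - r) * (r - x + t * (2 - x)) / (t * (2 - x ^ (2:ℕ) - (1 - x) * r) - x * (x - r))) := div_nonneg (mul_nonneg (by linarith) hre.le) hD.le
  have hcM1 : 0 ≤ ((x ^ (2:ℕ) + (1 - x) * d / w) * (1 - x) * ((x - r) * (1 - t - r) / (t * (2 - x ^ (2:ℕ) - (1 - x) * r) - x * (x - r)))) := mul_nonneg (mul_nonneg hg0 (by linarith)) hlam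
  have hcM2 : 0 ≤ ((x ^ (2:ℕ) + (1 - x) * d / w) * (1 - x) * ((1 + x - r) * (r - x + t * (2 - x)) / (t * (2 - x ^ (2:ℕ) - (1 - x) * r) - x * (x - r)))) := mul_nonneg (mul_nonneg hg0 (by linarith)) hlaml
  have hcM1pos : 0 < ((x ^ (2:ℕ) + (1 - x) * d / w) * (1 - x) * ((x - r) * (1 - t - r) / (t * (2 - x ^ (2:ℕ) - (1 - x) * r) - x * (x - r)))) := by
    apply mul_pos (mul_pos (by positivity) (by linarith))
    exact div_pos (mul_pos (by linarith) (by linarith)) hD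
  have hG4 : 0 < ((1 - x) * (r + d - 2 * w) + x ^ (2:ℕ) * (1 - w)) := by
    have h_1 := mul_pos (sub_pos.2 hx1) (show (0:ℝ) < r + d - 2 * w by linarith)
    have h_2 := mul_pos (mul_pos hx0 hx0) (sub_pos.2 hw1)
    linarith
  have he4num : 0 < (1 - w) - ((1 - x) * (r + d - 2 * w) + x ^ (2:ℕ) * (1 - w)) := by
    have h_1 := mul_pos (sub_pos.2 hx1) (show (0:ℝ) < (1 - w) * (1 + x) - (r + d - 2 * w) by have h_0 := mul_pos hx0 (sub_pos.2 hw1); linarith)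
    linarith
  have he4pos : 0 < (((1 - w) - ((1 - x) * (r + d - 2 * w) + x ^ (2:ℕ) * (1 - w))) / ((1 - x) * (r + d - 2 * w) + x ^ (2:ℕ) * (1 - w))) := div_pos he4num hG4
  have h4w : ((1 - x) / x) ≤ (((1 - w) - ((1 - x) * (r + d - 2 * w) + x ^ (2:ℕ) * (1 - w))) / ((1 - x) * (r + d - 2 * w) + x ^ (2:ℕ) * (1 - w))) := by
    have h1 : ((1 - x) * (r + d - 2 * w) + x ^ (2:ℕ) * (1 - w)) ≤ x * (1 - w) := by
      have h_1 := mul_nonneg (sub_pos.2 hx1).le (sub_nonneg.2 hb4.le)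
      linarith
    rw [div_le_div_iff₀ hx0 hG4]; linarith [h1]
  obtain ⟨hcP1, hpl1⟩ := hc4_f hf4
  rw [hcP1, hpl1] at hc3_f _hc3_s
  rw [hcP1] at hf3
  obtain ⟨hcP, hpl⟩ := hc3_f hf3
  rw [hcP] at hpre ⊢
  rw [hpl]
  clear hc4_f _hc4_s hc3_f _hc3_s
  rw [h3_H hk3] at *
  have hBp : 0 < (r + d + 2 * t) := by linarith
  have hG : 0 < ((1 - x) * (r + d) + x ^ (2:ℕ)) := by positivity
  have hGx : ((1 - x) * (r + d) + x ^ (2:ℕ)) < 1 := by linarith [mul_le_mul_of_nonneg_left h2L.le (sub_pos.2 hx1).le]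
  rw [h2P_L h2L] at hpre ⊢
  rw [hκ_L h1P h2L]
  have hκ0 : 0 ≤ ((1 + t) - (r + d + 2 * t)) * ((1 - x) * (r + d) + x ^ (2:ℕ)) / ((r + d + 2 * t) * (1 - ((1 - x) * (r + d) + x ^ (2:ℕ)))) :=
    div_nonneg (mul_nonneg (by linarith) hG.le) (mul_nonneg hBp.le (by linarith))
  have he2 : 0 ≤ (1 / ((1 - x) * (r + d) + x ^ (2:ℕ)) - 1) := by rw [sub_nonneg, le_div_iff₀ hG]; linarith [hGx]
  rcases le_or_gt (((1 - (x ^ (2:ℕ) + (1 - x) * d / w)) * (1 - x) * ((x - r) * (1 - t - r) / (t * (2 - x ^ (2:ℕ) - (1 - x) * r) - x * (x - r))))) (((x ^ (2:ℕ) + (1 - x) * d / w) * (1 - x))) with hQ | hQ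
  · have hprod := mul_nonneg (sub_nonneg.2 hpre) hκ0
    exact hQ.trans (le_add_of_nonneg_left hprod)
  · have hc := ineq_kB_4PLf3PHf_LHQp x r t d w hx0 hx1 hr0 hrx ht hw0 hw1 hd0 hdx hre hre1 hM2 hb4 hb4c hk3 hb3c hf4 hf3 h2L h1P (by simpa only [zero_mul, mul_zero, add_zero, zero_add] using hpre) hQ
    exact sub_nonneg.mp hc
set_option maxHeartbeats 8000000 in
/-- `kB` for pattern LLG, pre-routing pair `m+l` heavy, first pair available, head pair heavy (one branch of the case tree of `kB_LLG`). [this work] -/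
theorem kB_LLG_H1H (x r t d w e2P e3 κP cP1 pool1 cPres poolres : ℝ) (hx0 : 0 < x) (hx1 : x < 1) (hr0 : 0 ≤ r) (hrx : r < x) (ht : 0 < t) (hw0 : 0 < w) (hw1 : w < 1)
    (hd0 : 0 ≤ d) (hdx : d < x * w) (hre : 0 < r - x + t * (2 - x)) (hre1 : 0 < 1 - t - r)
    (_hM2 : 2 * w < r + d)
    (_h2P_N : 1 ≤ (r + d) → e2P = 0)
    (h2P_H : x ≤ (r + d) → (r + d) < 1 → e2P = (1 / (r + d) - 1))
    (_h2P_L : (r + d) < x → e2P = (1 / ((1 - x) * (r + d) + x ^ (2:ℕ)) - 1))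
    (h3_H : x * (1 + t - w) ≤ (r + d + 2 * t - 2 * w) → e3 = (((1 + t - w) - (r + d + 2 * t - 2 * w)) / (r + d + 2 * t - 2 * w)))
    (_h3_L : (r + d + 2 * t - 2 * w) < x * (1 + t - w) → e3 = (((1 + t - w) - ((1 - x) * (r + d + 2 * t - 2 * w) + x ^ (2:ℕ) * (1 + t - w))) / ((1 - x) * (r + d + 2 * t - 2 * w) + x ^ (2:ℕ) * (1 + t - w))))
    (_hκ_N : 1 + t ≤ (r + d + 2 * t) → κP = 0) (hκ_H : (r + d + 2 * t) < 1 + t → x ≤ (r + d) → (r + d) < 1 → κP = (((1 + t) - (r + d + 2 * t)) * (r + d) / ((r + d + 2 * t) * (1 - (r + d))))) (_hκ_L : (r + d + 2 * t) < 1 + t → (r + d) < x → κP = (((1 + t) - (r + d + 2 * t)) * ((1 - x) * (r + d) + x ^ (2:ℕ)) / ((r + d + 2 * t) * (1 - ((1 - x) * (r + d) + x ^ (2:ℕ))))))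
    (hc4_f : ((x ^ (2:ℕ) + (1 - x) * d / w) * (1 - x) * ((1 + x - r) * (r - x + t * (2 - x)) / (t * (2 - x ^ (2:ℕ) - (1 - x) * r) - x * (x - r)))) ≤ ((1 - (x ^ (2:ℕ) + (1 - x) * d / w)) * x) * (((1 - w) - ((1 - x) * (r + d - 2 * w) + x ^ (2:ℕ) * (1 - w))) / ((1 - x) * (r + d - 2 * w) + x ^ (2:ℕ) * (1 - w))) → cP1 = ((1 - (x ^ (2:ℕ) + (1 - x) * d / w)) * x) - ((x ^ (2:ℕ) + (1 - x) * d / w) * (1 - x) * ((1 + x - r) * (r - x + t * (2 - x)) / (t * (2 - x ^ (2:ℕ) - (1 - x) * r) - x * (x - r)))) / (((1 - w) - ((1 - x) * (r + d - 2 * w) + x ^ (2:ℕ) * (1 - w))) / ((1 - x) * (r + d - 2 * w) + x ^ (2:ℕ) * (1 - w))) ∧ pool1 = ((x ^ (2:ℕ) + (1 - x) * d / w) * (1 - x)))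
    (_hc4_s : ((1 - (x ^ (2:ℕ) + (1 - x) * d / w)) * x) * (((1 - w) - ((1 - x) * (r + d - 2 * w) + x ^ (2:ℕ) * (1 - w))) / ((1 - x) * (r + d - 2 * w) + x ^ (2:ℕ) * (1 - w))) < ((x ^ (2:ℕ) + (1 - x) * d / w) * (1 - x) * ((1 + x - r) * (r - x + t * (2 - x)) / (t * (2 - x ^ (2:ℕ) - (1 - x) * r) - x * (x - r)))) → cP1 = 0 ∧ pool1 = (((x ^ (2:ℕ) + (1 - x) * d / w) * (1 - x)) - ((x ^ (2:ℕ) + (1 - x) * d / w) * (1 - x) * ((1 + x - r) * (r - x + t * (2 - x)) / (t * (2 - x ^ (2:ℕ) - (1 - x) * r) - x * (x - r)))) + ((1 - (x ^ (2:ℕ) + (1 - x) * d / w)) * x) * (((1 - w) - ((1 - x) * (r + d - 2 * w) + x ^ (2:ℕ) * (1 - w))) / ((1 - x) * (r + d - 2 * w) + x ^ (2:ℕ) * (1 - w)))))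
    (hc3_f : ((x ^ (2:ℕ) + (1 - x) * d / w) * (1 - x) * ((x - r) * (1 - t - r) / (t * (2 - x ^ (2:ℕ) - (1 - x) * r) - x * (x - r)))) ≤ cP1 * e3 → cPres = cP1 - ((x ^ (2:ℕ) + (1 - x) * d / w) * (1 - x) * ((x - r) * (1 - t - r) / (t * (2 - x ^ (2:ℕ) - (1 - x) * r) - x * (x - r)))) / e3 ∧ poolres = pool1)
    (_hc3_s : cP1 * e3 < ((x ^ (2:ℕ) + (1 - x) * d / w) * (1 - x) * ((x - r) * (1 - t - r) / (t * (2 - x ^ (2:ℕ) - (1 - x) * r) - x * (x - r)))) → cPres = 0 ∧ poolres = (pool1 - ((x ^ (2:ℕ) + (1 - x) * d / w) * (1 - x) * ((x - r) * (1 - t - r) / (t * (2 - x ^ (2:ℕ) - (1 - x) * r) - x * (x - r)))) + cP1 * e3))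
    (hav : (r + d) < 1) (hf4 : ((x ^ (2:ℕ) + (1 - x) * d / w) * (1 - x) * ((1 + x - r) * (r - x + t * (2 - x)) / (t * (2 - x ^ (2:ℕ) - (1 - x) * r) - x * (x - r)))) ≤ ((1 - (x ^ (2:ℕ) + (1 - x) * d / w)) * x) * (((1 - w) - ((1 - x) * (r + d - 2 * w) + x ^ (2:ℕ) * (1 - w))) / ((1 - x) * (r + d - 2 * w) + x ^ (2:ℕ) * (1 - w)))) (hf3 : ((x ^ (2:ℕ) + (1 - x) * d / w) * (1 - x) * ((x - r) * (1 - t - r) / (t * (2 - x ^ (2:ℕ) - (1 - x) * r) - x * (x - r)))) ≤ cP1 * e3) (hpre : ((1 - (x ^ (2:ℕ) + (1 - x) * d / w)) * (1 - x) * ((1 + x - r) * (r - x + t * (2 - x)) / (t * (2 - x ^ (2:ℕ) - (1 - x) * r) - x * (x - r)))) ≤ cPres * e2P)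
    (hk3 : x * (1 + t - w) ≤ (r + d + 2 * t - 2 * w)) (h1P : (r + d + 2 * t) < 1 + t) (h2H : x ≤ (r + d)) :
    ((1 - (x ^ (2:ℕ) + (1 - x) * d / w)) * (1 - x) * ((x - r) * (1 - t - r) / (t * (2 - x ^ (2:ℕ) - (1 - x) * r) - x * (x - r)))) ≤ (cPres * e2P - ((1 - (x ^ (2:ℕ) + (1 - x) * d / w)) * (1 - x) * ((1 + x - r) * (r - x + t * (2 - x)) / (t * (2 - x ^ (2:ℕ) - (1 - x) * r) - x * (x - r))))) * κP + poolres := by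
  have hD : 0 < t * (2 - x ^ (2:ℕ) - (1 - x) * r) - x * (x - r) := LSCoreMMG.D_pos x r t hx0 hx1 hr0 hrx hre
  have hxw : x * w ≤ x := by
    have h_ := mul_pos hx0 (sub_pos.2 hw1)
    linarith
  have hb4 : r + d - 2 * w < x * (1 - w) := by
    have h_ := mul_pos hw0 (sub_pos.2 hx1)
    linarith
  have hb4c : r + d - 2 * w < 1 - w := by
    have h_ := mul_pos (sub_pos.2 hw1) (sub_pos.2 hx1)
    linarith
  have hb3c : r + d + 2 * t - 2 * w < 1 + t - w := by
    have h_ := mul_pos hw0 (sub_pos.2 hx1)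
    linarith
  have hg0 : 0 ≤ (x ^ (2:ℕ) + (1 - x) * d / w) := by positivity
  have hlam : 0 ≤ ((x - r) * (1 - t - r) / (t * (2 - x ^ (2:ℕ) - (1 - x) * r) - x * (x - r))) := div_nonneg (mul_nonneg (by linarith) (by linarith)) hD.le
  have hlaml : 0 ≤ ((1 + x - r) * (r - x + t * (2 - x)) / (t * (2 - x ^ (2:ℕ) - (1 - x) * r) - x * (x - r))) := div_nonneg (mul_nonneg (by linarith) hre.le) hD.le
  have hcM1 : 0 ≤ ((x ^ (2:ℕ) + (1 - x) * d / w) * (1 - x) * ((x - r) * (1 - t - r) / (t * (2 - x ^ (2:ℕ) - (1 - x) * r) - x * (x - r)))) := mul_nonneg (mul_nonneg hg0 (by linarith)) hlam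
  have hcM2 : 0 ≤ ((x ^ (2:ℕ) + (1 - x) * d / w) * (1 - x) * ((1 + x - r) * (r - x + t * (2 - x)) / (t * (2 - x ^ (2:ℕ) - (1 - x) * r) - x * (x - r)))) := mul_nonneg (mul_nonneg hg0 (by linarith)) hlaml
  have hcM1pos : 0 < ((x ^ (2:ℕ) + (1 - x) * d / w) * (1 - x) * ((x - r) * (1 - t - r) / (t * (2 - x ^ (2:ℕ) - (1 - x) * r) - x * (x - r)))) := by
    apply mul_pos (mul_pos (by positivity) (by linarith))
    exact div_pos (mul_pos (by linarith) (by linarith)) hD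
  have hG4 : 0 < ((1 - x) * (r + d - 2 * w) + x ^ (2:ℕ) * (1 - w)) := by
    have h_1 := mul_pos (sub_pos.2 hx1) (show (0:ℝ) < r + d - 2 * w by linarith)
    have h_2 := mul_pos (mul_pos hx0 hx0) (sub_pos.2 hw1)
    linarith
  have he4num : 0 < (1 - w) - ((1 - x) * (r + d - 2 * w) + x ^ (2:ℕ) * (1 - w)) := by
    have h_1 := mul_pos (sub_pos.2 hx1) (show (0:ℝ) < (1 - w) * (1 + x) - (r + d - 2 * w) by have h_0 := mul_pos hx0 (sub_pos.2 hw1); linarith)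
    linarith
  have he4pos : 0 < (((1 - w) - ((1 - x) * (r + d - 2 * w) + x ^ (2:ℕ) * (1 - w))) / ((1 - x) * (r + d - 2 * w) + x ^ (2:ℕ) * (1 - w))) := div_pos he4num hG4
  have h4w : ((1 - x) / x) ≤ (((1 - w) - ((1 - x) * (r + d - 2 * w) + x ^ (2:ℕ) * (1 - w))) / ((1 - x) * (r + d - 2 * w) + x ^ (2:ℕ) * (1 - w))) := by
    have h1 : ((1 - x) * (r + d - 2 * w) + x ^ (2:ℕ) * (1 - w)) ≤ x * (1 - w) := by
      have h_1 := mul_nonneg (sub_pos.2 hx1).le (sub_nonneg.2 hb4.le)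
      linarith
    rw [div_le_div_iff₀ hx0 hG4]; linarith [h1]
  obtain ⟨hcP1, hpl1⟩ := hc4_f hf4
  rw [hcP1, hpl1] at hc3_f _hc3_s
  rw [hcP1] at hf3
  obtain ⟨hcP, hpl⟩ := hc3_f hf3
  rw [hcP] at hpre ⊢
  rw [hpl]
  clear hc4_f _hc4_s hc3_f _hc3_s
  rw [h3_H hk3] at *
  have hBp : 0 < (r + d + 2 * t) := by linarith
  rw [h2P_H h2H hav] at hpre ⊢
  rw [hκ_H h1P h2H hav]
  have hA1 : 0 < 1 - (r + d) := by linarith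
  have hκ0 : 0 ≤ ((1 + t) - (r + d + 2 * t)) * (r + d) / ((r + d + 2 * t) * (1 - (r + d))) :=
    div_nonneg (mul_nonneg (by linarith) (by linarith)) (mul_nonneg hBp.le hA1.le)
  have he2 : 0 ≤ (1 / (r + d) - 1) := by rw [sub_nonneg, le_div_iff₀ (show (0:ℝ) < (r + d) by linarith)]; linarith
  have hQ := LSCoreLMG.P1_le_pool_2PH_3PH x r t d w hx0 hx1 hr0 hrx ht hw0 hw1.le hd0 hdx hre hre1 h2H hk3
  have hprod := mul_nonneg (sub_nonneg.2 hpre) hκ0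
  exact hQ.trans (le_add_of_nonneg_left hprod)
set_option maxHeartbeats 8000000 in
/-- `kB` for pattern LLG, pre-routing pair `m+l` heavy, first pair unavailable (one branch of the case tree of `kB_LLG`). [this work] -/
theorem kB_LLG_H0 (x r t d w e2P e3 κP cP1 pool1 cPres poolres : ℝ) (hx0 : 0 < x) (hx1 : x < 1) (hr0 : 0 ≤ r) (hrx : r < x) (ht : 0 < t) (hw0 : 0 < w) (hw1 : w < 1)
    (hd0 : 0 ≤ d) (hdx : d < x * w) (hre : 0 < r - x + t * (2 - x)) (hre1 : 0 < 1 - t - r)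
    (hM2 : 2 * w < r + d)
    (_h2P_N : 1 ≤ (r + d) → e2P = 0)
    (_h2P_H : x ≤ (r + d) → (r + d) < 1 → e2P = (1 / (r + d) - 1))
    (_h2P_L : (r + d) < x → e2P = (1 / ((1 - x) * (r + d) + x ^ (2:ℕ)) - 1))
    (h3_H : x * (1 + t - w) ≤ (r + d + 2 * t - 2 * w) → e3 = (((1 + t - w) - (r + d + 2 * t - 2 * w)) / (r + d + 2 * t - 2 * w)))
    (_h3_L : (r + d + 2 * t - 2 * w) < x * (1 + t - w) → e3 = (((1 + t - w) - ((1 - x) * (r + d + 2 * t - 2 * w) + x ^ (2:ℕ) * (1 + t - w))) / ((1 - x) * (r + d + 2 * t - 2 * w) + x ^ (2:ℕ) * (1 + t - w))))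
    (hκ_N : 1 + t ≤ (r + d + 2 * t) → κP = 0) (_hκ_H : (r + d + 2 * t) < 1 + t → x ≤ (r + d) → (r + d) < 1 → κP = (((1 + t) - (r + d + 2 * t)) * (r + d) / ((r + d + 2 * t) * (1 - (r + d))))) (_hκ_L : (r + d + 2 * t) < 1 + t → (r + d) < x → κP = (((1 + t) - (r + d + 2 * t)) * ((1 - x) * (r + d) + x ^ (2:ℕ)) / ((r + d + 2 * t) * (1 - ((1 - x) * (r + d) + x ^ (2:ℕ))))))
    (hc4_f : ((x ^ (2:ℕ) + (1 - x) * d / w) * (1 - x) * ((1 + x - r) * (r - x + t * (2 - x)) / (t * (2 - x ^ (2:ℕ) - (1 - x) * r) - x * (x - r)))) ≤ ((1 - (x ^ (2:ℕ) + (1 - x) * d / w)) * x) * (((1 - w) - ((1 - x) * (r + d - 2 * w) + x ^ (2:ℕ) * (1 - w))) / ((1 - x) * (r + d - 2 * w) + x ^ (2:ℕ) * (1 - w))) → cP1 = ((1 - (x ^ (2:ℕ) + (1 - x) * d / w)) * x) - ((x ^ (2:ℕ) + (1 - x) * d / w) * (1 - x) * ((1 + x - r) * (r - x + t * (2 - x))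 / (t * (2 - x ^ (2:ℕ) - (1 - x) * r) - x * (x - r)))) / (((1 - w) - ((1 - x) * (r + d - 2 * w) + x ^ (2:ℕ) * (1 - w))) / ((1 - x) * (r + d - 2 * w) + x ^ (2:ℕ) * (1 - w))) ∧ pool1 = ((x ^ (2:ℕ) + (1 - x) * d / w) * (1 - x)))
    (_hc4_s : ((1 - (x ^ (2:ℕ) + (1 - x) * d / w)) * x) * (((1 - w) - ((1 - x) * (r + d - 2 * w) + x ^ (2:ℕ) * (1 - w))) / ((1 - x) * (r + d - 2 * w) + x ^ (2:ℕ) * (1 - w))) < ((x ^ (2:ℕ) + (1 - x) * d / w) * (1 - x) * ((1 + x - r) * (r - x + t * (2 - x)) / (t * (2 - x ^ (2:ℕ) - (1 - x) * r) - x * (x - r)))) → cP1 = 0 ∧ pool1 = (((x ^ (2:ℕ) + (1 - x) * d / w) * (1 - x)) - ((x ^ (2:ℕ) + (1 - x) * d / w) * (1 - x) * ((1 + x - r) * (r - x + t * (2 - x)) / (t * (2 - x ^ (2:ℕ) - (1 - x) * r) - x * (x - r)))) + ((1 - (x ^ (2:ℕ) + (1 - x) * d / w)) * x) * (((1 - w)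 - ((1 - x) * (r + d - 2 * w) + x ^ (2:ℕ) * (1 - w))) / ((1 - x) * (r + d - 2 * w) + x ^ (2:ℕ) * (1 - w)))))
    (hc3_f : ((x ^ (2:ℕ) + (1 - x) * d / w) * (1 - x) * ((x - r) * (1 - t - r) / (t * (2 - x ^ (2:ℕ) - (1 - x) * r) - x * (x - r)))) ≤ cP1 * e3 → cPres = cP1 - ((x ^ (2:ℕ) + (1 - x) * d / w) * (1 - x) * ((x - r) * (1 - t - r) / (t * (2 - x ^ (2:ℕ) - (1 - x) * r) - x * (x - r)))) / e3 ∧ poolres = pool1)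
    (_hc3_s : cP1 * e3 < ((x ^ (2:ℕ) + (1 - x) * d / w) * (1 - x) * ((x - r) * (1 - t - r) / (t * (2 - x ^ (2:ℕ) - (1 - x) * r) - x * (x - r)))) → cPres = 0 ∧ poolres = (pool1 - ((x ^ (2:ℕ) + (1 - x) * d / w) * (1 - x) * ((x - r) * (1 - t - r) / (t * (2 - x ^ (2:ℕ) - (1 - x) * r) - x * (x - r)))) + cP1 * e3))
    (_hav : (r + d) < 1) (hf4 : ((x ^ (2:ℕ) + (1 - x) * d / w) * (1 - x) * ((1 + x - r) * (r - x + t * (2 - x)) / (t * (2 - x ^ (2:ℕ) - (1 - x) * r) - x * (x - r)))) ≤ ((1 - (x ^ (2:ℕ) + (1 - x) * d / w)) * x) * (((1 - w) - ((1 - x) * (r + d - 2 * w) + x ^ (2:ℕ) * (1 - w))) / ((1 - x) * (r + d - 2 * w) + x ^ (2:ℕ) * (1 - w)))) (hf3 : ((x ^ (2:ℕ) + (1 - x) * d / w) * (1 - x) * ((x - r) * (1 - t - r) / (t * (2 - x ^ (2:ℕ) - (1 - x) * r) - x * (x - r)))) ≤ cP1 * e3) (_hpre : ((1 - (x ^ (2:ℕ)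 + (1 - x) * d / w)) * (1 - x) * ((1 + x - r) * (r - x + t * (2 - x)) / (t * (2 - x ^ (2:ℕ) - (1 - x) * r) - x * (x - r)))) ≤ cPres * e2P)
    (hk3 : x * (1 + t - w) ≤ (r + d + 2 * t - 2 * w)) (h1Pn : 1 + t ≤ (r + d + 2 * t))  :
    ((1 - (x ^ (2:ℕ) + (1 - x) * d / w)) * (1 - x) * ((x - r) * (1 - t - r) / (t * (2 - x ^ (2:ℕ) - (1 - x) * r) - x * (x - r)))) ≤ (cPres * e2P - ((1 - (x ^ (2:ℕ) + (1 - x) * d / w)) * (1 - x) * ((1 + x - r) * (r - x + t * (2 - x)) / (t * (2 - x ^ (2:ℕ) - (1 - x) * r) - x * (x - r))))) * κP + poolres := by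
  have hD : 0 < t * (2 - x ^ (2:ℕ) - (1 - x) * r) - x * (x - r) := LSCoreMMG.D_pos x r t hx0 hx1 hr0 hrx hre
  have hxw : x * w ≤ x := by
    have h_ := mul_pos hx0 (sub_pos.2 hw1)
    linarith
  have hb4 : r + d - 2 * w < x * (1 - w) := by
    have h_ := mul_pos hw0 (sub_pos.2 hx1)
    linarith
  have hb4c : r + d - 2 * w < 1 - w := by
    have h_ := mul_pos (sub_pos.2 hw1) (sub_pos.2 hx1)
    linarith
  have hb3c : r + d + 2 * t - 2 * w < 1 + t - w := by
    have h_ := mul_pos hw0 (sub_pos.2 hx1)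
    linarith
  have hg0 : 0 ≤ (x ^ (2:ℕ) + (1 - x) * d / w) := by positivity
  have hlam : 0 ≤ ((x - r) * (1 - t - r) / (t * (2 - x ^ (2:ℕ) - (1 - x) * r) - x * (x - r))) := div_nonneg (mul_nonneg (by linarith) (by linarith)) hD.le
  have hlaml : 0 ≤ ((1 + x - r) * (r - x + t * (2 - x)) / (t * (2 - x ^ (2:ℕ) - (1 - x) * r) - x * (x - r))) := div_nonneg (mul_nonneg (by linarith) hre.le) hD.le
  have hcM1 : 0 ≤ ((x ^ (2:ℕ) + (1 - x) * d / w) * (1 - x) * ((x - r) * (1 - t - r) / (t * (2 - x ^ (2:ℕ) - (1 - x) * r) - x * (x - r)))) := mul_nonneg (mul_nonneg hg0 (by linarith)) hlam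
  have hcM2 : 0 ≤ ((x ^ (2:ℕ) + (1 - x) * d / w) * (1 - x) * ((1 + x - r) * (r - x + t * (2 - x)) / (t * (2 - x ^ (2:ℕ) - (1 - x) * r) - x * (x - r)))) := mul_nonneg (mul_nonneg hg0 (by linarith)) hlaml
  have hcM1pos : 0 < ((x ^ (2:ℕ) + (1 - x) * d / w) * (1 - x) * ((x - r) * (1 - t - r) / (t * (2 - x ^ (2:ℕ) - (1 - x) * r) - x * (x - r)))) := by
    apply mul_pos (mul_pos (by positivity) (by linarith))
    exact div_pos (mul_pos (by linarith) (by linarith)) hD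
  have hG4 : 0 < ((1 - x) * (r + d - 2 * w) + x ^ (2:ℕ) * (1 - w)) := by
    have h_1 := mul_pos (sub_pos.2 hx1) (show (0:ℝ) < r + d - 2 * w by linarith)
    have h_2 := mul_pos (mul_pos hx0 hx0) (sub_pos.2 hw1)
    linarith
  have he4num : 0 < (1 - w) - ((1 - x) * (r + d - 2 * w) + x ^ (2:ℕ) * (1 - w)) := by
    have h_1 := mul_pos (sub_pos.2 hx1) (show (0:ℝ) < (1 - w) * (1 + x) - (r + d - 2 * w) by have h_0 := mul_pos hx0 (sub_pos.2 hw1); linarith)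
    linarith
  have he4pos : 0 < (((1 - w) - ((1 - x) * (r + d - 2 * w) + x ^ (2:ℕ) * (1 - w))) / ((1 - x) * (r + d - 2 * w) + x ^ (2:ℕ) * (1 - w))) := div_pos he4num hG4
  have h4w : ((1 - x) / x) ≤ (((1 - w) - ((1 - x) * (r + d - 2 * w) + x ^ (2:ℕ) * (1 - w))) / ((1 - x) * (r + d - 2 * w) + x ^ (2:ℕ) * (1 - w))) := by
    have h1 : ((1 - x) * (r + d - 2 * w) + x ^ (2:ℕ) * (1 - w)) ≤ x * (1 - w) := by
      have h_1 := mul_nonneg (sub_pos.2 hx1).le (sub_nonneg.2 hb4.le)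
      linarith
    rw [div_le_div_iff₀ hx0 hG4]; linarith [h1]
  obtain ⟨hcP1, hpl1⟩ := hc4_f hf4
  rw [hcP1, hpl1] at hc3_f _hc3_s
  rw [hcP1] at hf3
  obtain ⟨hcP, hpl⟩ := hc3_f hf3
  rw [hcP] at _hpre ⊢
  rw [hpl]
  clear hc4_f _hc4_s hc3_f _hc3_s
  rw [h3_H hk3] at *
  rw [hκ_N h1Pn]
  have hc := ineq_kB0_4PLf3PHf x r t d w hx0 hx1 hr0 hrx ht hw0 hw1 hd0 hdx hre hre1 hM2 hb4 hb4c hk3 hb3c hf4 hf3 h1Pn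
  simp only [mul_zero, zero_add]; exact sub_nonneg.mp hc

set_option maxHeartbeats 8000000 in
/-- `kB` for pattern LLG, pre-routing pair `m+l` heavy (half of the case tree of `kB_LLG`). [this work] -/
theorem kB_LLG_H (x r t d w e2P e3 κP cP1 pool1 cPres poolres : ℝ) (hx0 : 0 < x) (hx1 : x < 1) (hr0 : 0 ≤ r) (hrx : r < x) (ht : 0 < t) (hw0 : 0 < w) (hw1 : w < 1)
    (hd0 : 0 ≤ d) (hdx : d < x * w) (hre : 0 < r - x + t * (2 - x)) (hre1 : 0 < 1 - t - r)
    (hM2 : 2 * w < r + d)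
    (h2P_N : 1 ≤ (r + d) → e2P = 0)
    (h2P_H : x ≤ (r + d) → (r + d) < 1 → e2P = (1 / (r + d) - 1))
    (h2P_L : (r + d) < x → e2P = (1 / ((1 - x) * (r + d) + x ^ (2:ℕ)) - 1))
    (h3_H : x * (1 + t - w) ≤ (r + d + 2 * t - 2 * w) → e3 = (((1 + t - w) - (r + d + 2 * t - 2 * w)) / (r + d + 2 * t - 2 * w)))
    (h3_L : (r + d + 2 * t - 2 * w) < x * (1 + t - w) → e3 = (((1 + t - w) - ((1 - x) * (r + d + 2 * t - 2 * w) + x ^ (2:ℕ) * (1 + t - w))) / ((1 - x) * (r + d + 2 * t - 2 * w) + x ^ (2:ℕ) * (1 + t - w))))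
    (hκ_N : 1 + t ≤ (r + d + 2 * t) → κP = 0) (hκ_H : (r + d + 2 * t) < 1 + t → x ≤ (r + d) → (r + d) < 1 → κP = (((1 + t) - (r + d + 2 * t)) * (r + d) / ((r + d + 2 * t) * (1 - (r + d))))) (hκ_L : (r + d + 2 * t) < 1 + t → (r + d) < x → κP = (((1 + t) - (r + d + 2 * t)) * ((1 - x) * (r + d) + x ^ (2:ℕ)) / ((r + d + 2 * t) * (1 - ((1 - x) * (r + d) + x ^ (2:ℕ))))))
    (hc4_f : ((x ^ (2:ℕ) + (1 - x) * d / w) * (1 - x) * ((1 + x - r) * (r - x + t * (2 - x)) / (t * (2 - x ^ (2:ℕ) - (1 - x) * r) - x * (x - r)))) ≤ ((1 - (x ^ (2:ℕ) + (1 - x) * d / w)) * x) * (((1 - w) - ((1 - x) * (r + d - 2 * w) + x ^ (2:ℕ) * (1 - w))) / ((1 - x) * (r + d - 2 * w) + x ^ (2:ℕ) * (1 - w))) → cP1 = ((1 - (x ^ (2:ℕ) + (1 - x) * d / w)) * x) - ((x ^ (2:ℕ) + (1 - x) * d / w) * (1 - x) * ((1 + x - r) * (r - x + t * (2 - x)) /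 (t * (2 - x ^ (2:ℕ) - (1 - x) * r) - x * (x - r)))) / (((1 - w) - ((1 - x) * (r + d - 2 * w) + x ^ (2:ℕ) * (1 - w))) / ((1 - x) * (r + d - 2 * w) + x ^ (2:ℕ) * (1 - w))) ∧ pool1 = ((x ^ (2:ℕ) + (1 - x) * d / w) * (1 - x)))
    (hc4_s : ((1 - (x ^ (2:ℕ) + (1 - x) * d / w)) * x) * (((1 - w) - ((1 - x) * (r + d - 2 * w) + x ^ (2:ℕ) * (1 - w))) / ((1 - x) * (r + d - 2 * w) + x ^ (2:ℕ) * (1 - w))) < ((x ^ (2:ℕ) + (1 - x) * d / w) * (1 - x) * ((1 + x - r) * (r - x + t * (2 - x)) / (t * (2 - x ^ (2:ℕ) - (1 - x) * r) - x * (x - r)))) → cP1 = 0 ∧ pool1 = (((x ^ (2:ℕ) + (1 - x) * d / w) * (1 - x)) - ((x ^ (2:ℕ) + (1 - x) * d / w) * (1 - x) * ((1 + x - r) * (r - x + t * (2 - x)) / (t * (2 - x ^ (2:ℕ) - (1 - x) * r) - x * (x - r)))) + ((1 - (x ^ (2:ℕ) + (1 - x) * d / w)) * x) * (((1 - w) -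 ((1 - x) * (r + d - 2 * w) + x ^ (2:ℕ) * (1 - w))) / ((1 - x) * (r + d - 2 * w) + x ^ (2:ℕ) * (1 - w)))))
    (hc3_f : ((x ^ (2:ℕ) + (1 - x) * d / w) * (1 - x) * ((x - r) * (1 - t - r) / (t * (2 - x ^ (2:ℕ) - (1 - x) * r) - x * (x - r)))) ≤ cP1 * e3 → cPres = cP1 - ((x ^ (2:ℕ) + (1 - x) * d / w) * (1 - x) * ((x - r) * (1 - t - r) / (t * (2 - x ^ (2:ℕ) - (1 - x) * r) - x * (x - r)))) / e3 ∧ poolres = pool1)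
    (hc3_s : cP1 * e3 < ((x ^ (2:ℕ) + (1 - x) * d / w) * (1 - x) * ((x - r) * (1 - t - r) / (t * (2 - x ^ (2:ℕ) - (1 - x) * r) - x * (x - r)))) → cPres = 0 ∧ poolres = (pool1 - ((x ^ (2:ℕ) + (1 - x) * d / w) * (1 - x) * ((x - r) * (1 - t - r) / (t * (2 - x ^ (2:ℕ) - (1 - x) * r) - x * (x - r)))) + cP1 * e3))
    (hav : (r + d) < 1) (hf4 : ((x ^ (2:ℕ) + (1 - x) * d / w) * (1 - x) * ((1 + x - r) * (r - x + t * (2 - x)) / (t * (2 - x ^ (2:ℕ) - (1 - x) * r) - x * (x - r)))) ≤ ((1 - (x ^ (2:ℕ) + (1 - x) * d / w)) * x) * (((1 - w) - ((1 - x) * (r + d - 2 * w) + x ^ (2:ℕ) * (1 - w))) / ((1 - x) * (r + d - 2 * w) + x ^ (2:ℕ) * (1 - w)))) (hf3 : ((x ^ (2:ℕ) + (1 - x) * d / w) * (1 - x) * ((x - r) * (1 - t - r) / (t * (2 - x ^ (2:ℕ) - (1 - x) * r) - x * (x - r)))) ≤ cP1 * e3) (hpre : ((1 - (x ^ (2:ℕ)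 + (1 - x) * d / w)) * (1 - x) * ((1 + x - r) * (r - x + t * (2 - x)) / (t * (2 - x ^ (2:ℕ) - (1 - x) * r) - x * (x - r)))) ≤ cPres * e2P)
    (hk3 : x * (1 + t - w) ≤ (r + d + 2 * t - 2 * w)) :
    ((1 - (x ^ (2:ℕ) + (1 - x) * d / w)) * (1 - x) * ((x - r) * (1 - t - r) / (t * (2 - x ^ (2:ℕ) - (1 - x) * r) - x * (x - r)))) ≤ (cPres * e2P - ((1 - (x ^ (2:ℕ) + (1 - x) * d / w)) * (1 - x) * ((1 + x - r) * (r - x + t * (2 - x)) / (t * (2 - x ^ (2:ℕ) - (1 - x) * r) - x * (x - r))))) * κP + poolres := by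
  rcases lt_or_ge ((r + d + 2 * t)) (1 + t) with h1P | h1Pn
  · rcases lt_or_ge ((r + d)) x with h2L | h2H
    · exact kB_LLG_H1L x r t d w e2P e3 κP cP1 pool1 cPres poolres hx0 hx1 hr0 hrx ht hw0 hw1 hd0 hdx hre hre1 hM2 h2P_N h2P_H h2P_L h3_H h3_L hκ_N hκ_H hκ_L hc4_f hc4_s hc3_f hc3_s hav hf4 hf3 hpre hk3 h1P h2L
    · exact kB_LLG_H1H x r t d w e2P e3 κP cP1 pool1 cPres poolres hx0 hx1 hr0 hrx ht hw0 hw1 hd0 hdx hre hre1 hM2 h2P_N h2P_H h2P_L h3_H h3_L hκ_N hκ_H hκ_L hc4_f hc4_s hc3_f hc3_s hav hf4 hf3 hpre hk3 h1P h2H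
  · exact kB_LLG_H0 x r t d w e2P e3 κP cP1 pool1 cPres poolres hx0 hx1 hr0 hrx ht hw0 hw1 hd0 hdx hre hre1 hM2 h2P_N h2P_H h2P_L h3_H h3_L hκ_N hκ_H hκ_L hc4_f hc4_s hc3_f hc3_s hav hf4 hf3 hpre hk3 h1Pn

end LSCoreLLG

end LawDec

end Quant

end Summit.CriticalPhenomena.PercolationContinuityZ3.Theorems
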